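import Literature.Algebra.GroupRings.SubgroupProjection
import Literature.Algebra.GroupRings.MaschkeTheoremGeneralRing
import Literature.RingTheory.JacobsonRadical.VonNeumannRegularRings
import Mathlib.GroupTheory.Perm.Cycle.Type
import Mathlib.Data.Nat.Factorization.Induction
import HarnessLib

/-!
# Lam §6 Exercise 6.21 (Auslander, McLaughlin, Connell): von Neumann regular group rings

[cite: Lam2001FirstCourse, §6 Exercise 6.21, p. 99]

Lam, *A First Course in Noncommutative Rings*, Exercises for §6 (p. 99; p0111 of the held scan):

**Ex. 6.21.** (Auslander, McLaughlin, Connell) For any nonzero ring `k` and any group `G`, show that the group ring `kG` is von Neumann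
regular iff `k` is von Neumann regular, `G` is locally finite (that is, any finite subset in `G` generates a finite subgroup), and the order
of any finite subgroup of `G` is a unit in `k`. (**Hint.** For the "only if" part, use the fact that, if `h₁, …, hₙ` generate a subgroup
`H ⊆ G`, then `Σ_{h ∈ H} kG·(h − 1) = Σᵢ kG·(hᵢ − 1)`. The "if" part can be deduced from Exercise 19 and (1) of Exercise 3.)

As in the tree's `VonNeumannRegularRings` ((4.23)–(4.27)), «von Neumann regular» is spelled out: `∀ a, ∃ x, a * x * a = a`.

## Contents

* §1 Regularity passes from `kG` to `k` (a homomorphic image, via the augmentation) and to `kH` for every subgroup `H` (apply the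
  tree's projection `π_H`, a `(kH, kH)`-bimodule retraction).
* §2 **«Only if»**, as printed: `k` is von Neumann regular (`forall_exists_mul_mul_self_coeff`); the order of every finite subgroup is
  a unit (`isUnit_natCard_of_forall_exists_mul_mul_self`: Cauchy + the tree's `isUnit_orderOf_of_forall_exists_mul_mul_self` from the
  proof of (6.1) + induction over the prime factorisation); `G` is locally finite (`finite_of_fg_of_forall_exists_mul_mul_self`), by the
  hint: for `H = ⟨h₁, …, hₙ⟩` the left ideal `L = Σ_{h∈H} kG(h − 1) = Σᵢ kG(hᵢ − 1)` is finitely generated, hence `L = kG·e` for an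
  idempotent `e` ((4.23)); then `f = 1 − e` satisfies `hf = f` for all `h ∈ H`, and `f ≠ 0` because the functional `ε_H ∘ π_H` kills `L`
  but not `1`; a nonzero `f` with `hf = f` for all `h ∈ H` forces `H` finite.
* §3 **«If»** in the case of a SEMISIMPLE coefficient ring `k` (fields in particular): locally finite `G` with all finite subgroup orders
  invertible makes every `α ∈ kG` live in some `kH`, `H` finite, which is semisimple by Maschke (tree, (6.1)), hence von Neumann
  regular; with §2 this gives the «iff» for semisimple `k` (`forall_exists_mul_mul_self_iff_of_isSemisimpleRing`).
-- TODO(general form): the «if» direction for an arbitrary von Neumann regular `k` needs Exercise 6.19 (finitely generated submodules of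
-- projective modules over a von Neumann regular ring are direct summands), not yet in the tree.

## References

* [Lam2001FirstCourse] T. Y. Lam, *A First Course in Noncommutative Rings*, 2nd ed., Graduate Texts in Mathematics 131, Springer, 2001,
  §6 Exercise 6.21, p. 99 (held scan `book:lamnd-first-course-noncommutative-rings`, p0111); proof of Thm. (6.1) (pp. 79–80).
-/

universe u w

namespace Literature.Algebra.GroupRings

open MonoidAlgebra Literature.RingTheory.JacobsonRadical

variable {k : Type u} [Ring k] {G : Type w} [Group G]

/-! ## §1 Regularity of `kG` passes to `k` and to `kH` -/

variable (k G) in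
/-- The augmentation `ε : kG → k`, `ε|_k = id`, `ε(G) = 1`, is onto. [cite: Lam2001FirstCourse, §6 proof of Thm. (6.1) («the augmentation
map»)] -/
theorem liftNCRingHom_id_one_surjective :
    Function.Surjective (liftNCRingHom (RingHom.id k) (1 : G →* k) fun _ _ ↦ by simp : MonoidAlgebra k G →+* k) := fun a ↦
  ⟨single 1 a, by rw [liftNCRingHom_single, MonoidHom.one_apply, mul_one, RingHom.id_apply]⟩

/-- **`kG` von Neumann regular ⟹ `k` von Neumann regular** (`k` is a homomorphic image of `kG`). [cite: Lam2001FirstCourse, §6 Exercise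
6.21, «only if»] -/
theorem forall_exists_mul_mul_self_coeff (hR : ∀ x : MonoidAlgebra k G, ∃ y, x * y * x = x) : ∀ a : k, ∃ b, a * b * a = a :=
  forall_exists_mul_mul_self_of_surjective _ (liftNCRingHom_id_one_surjective k G) hR

/-- **`kG` von Neumann regular ⟹ `kH` von Neumann regular for every subgroup `H`** (project a quasi-inverse with `π_H`).
[cite: Lam2001FirstCourse, §6 Exercise 6.21] -/
theorem forall_exists_mul_mul_self_subgroup (hR : ∀ x : MonoidAlgebra k G, ∃ y, x * y * x = x) (H : Subgroup G) :
    ∀ α : MonoidAlgebra k H, ∃ β, α * β * α = α := fun α ↦ by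
  obtain ⟨y, hy⟩ := hR (mapDomain H.subtype α)
  refine ⟨subgroupProj H y, ?_⟩
  have h := congrArg (subgroupProj H) hy
  rwa [subgroupProj_mapDomain_mul_mul_mapDomain, ← mul_one (mapDomain H.subtype α), subgroupProj_mapDomain_mul, subgroupProj_one,
    mul_one] at h

/-! ## §2 «Only if»: orders of finite subgroups are units; `G` is locally finite -/

/-- If every prime divisor of `n ≠ 0` is a unit of `k`, so is `n`. [folklore] -/
private theorem isUnit_natCast_of_forall_prime {n : ℕ} (hn : n ≠ 0) (h : ∀ p : ℕ, p.Prime → p ∣ n → IsUnit (p : k)) : IsUnit (n : k) := by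
  induction n using induction_on_primes with
  | zero => exact absurd rfl hn
  | one => rw [Nat.cast_one]; exact isUnit_one
  | prime_mul p a hp ih =>
    rw [Nat.cast_mul]
    exact (h p hp (dvd_mul_right p a)).mul (ih (right_ne_zero_of_mul hn) fun q hq hqa ↦ h q hq (dvd_mul_of_dvd_right hqa p))

/-- **LAM Exercise 6.21, «only if»: if `kG` is von Neumann regular, the order of every finite subgroup of `G` is a unit in `k`** — every
prime `p ∣ |H|` is the order of an element (Cauchy), hence a unit by the argument of (6.1). [cite: Lam2001FirstCourse, §6 Exercise 6.21] -/
theorem isUnit_natCard_of_forall_exists_mul_mul_self (hR : ∀ x : MonoidAlgebra k G, ∃ y, x * y * x = x) (H : Subgroup G) [Finite H] :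
    IsUnit (Nat.card H : k) := by
  refine isUnit_natCast_of_forall_prime Nat.card_pos.ne' fun p hp hdvd ↦ ?_
  haveI : Fact p.Prime := ⟨hp⟩
  obtain ⟨x, hx⟩ := exists_prime_orderOf_dvd_card' p hdvd
  have hx' : orderOf (x : G) = p := by rw [Subgroup.orderOf_coe, hx]
  rw [← hx']
  exact isUnit_orderOf_of_forall_exists_mul_mul_self hR (orderOf_pos_iff.1 (by rw [hx']; exact hp.pos))

/-- «`Σ_{h∈H} kG·(h − 1) = Σᵢ kG·(hᵢ − 1)`»: if `S` generates `H` then every `h − 1`, `h ∈ H`, lies in the left ideal generated by the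
`s − 1`, `s ∈ S` (`gh − 1 = g(h − 1) + (g − 1)`, `h⁻¹ − 1 = −h⁻¹(h − 1)`). [cite: Lam2001FirstCourse, §6 Exercise 6.21 (Hint)] -/
theorem single_sub_one_mem_span_of_mem_closure {S : Set G} {h : G} (hh : h ∈ Subgroup.closure S) :
    single h (1 : k) - 1 ∈ Ideal.span ((fun s : G ↦ (single s (1 : k) - 1 : MonoidAlgebra k G)) '' S) := by
  induction hh using Subgroup.closure_induction with
  | mem s hs => exact Ideal.subset_span ⟨s, hs, rfl⟩
  | one => rw [← one_def, sub_self]; exact Submodule.zero_mem _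
  | mul x y _ _ hx hy =>
    have h1 : (single (x * y) (1 : k) - 1 : MonoidAlgebra k G) = single x 1 * (single y 1 - 1) + (single x 1 - 1) := by
      rw [mul_sub, single_mul_single, mul_one, mul_one, sub_add_sub_cancel]
    rw [h1]
    exact add_mem (Ideal.mul_mem_left _ _ hy) hx
  | inv x _ hx =>
    have h1 : (single x⁻¹ (1 : k) - 1 : MonoidAlgebra k G) = -(single x⁻¹ 1 * (single x 1 - 1)) := by
      rw [mul_sub, single_mul_single, inv_mul_cancel, mul_one, ← one_def, mul_one, neg_sub]
    rw [h1]
    exact neg_mem (Ideal.mul_mem_left _ _ hx)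

/-- The additive functional `λ = ε_H ∘ π_H : kG → k` kills the left ideal `Σ_{h∈H} kG(h − 1)`: `λ(a(h − 1)) = ε_H(π_H(a)(h − 1)) = 0`.
[cite: Lam2001FirstCourse, §6 Exercise 6.21] -/
theorem augmentation_subgroupProj_eq_zero_of_mem_span (H : Subgroup G) {S : Set G} (hS : S ⊆ H) {z : MonoidAlgebra k G}
    (hz : z ∈ Ideal.span ((fun s : G ↦ (single s (1 : k) - 1 : MonoidAlgebra k G)) '' S)) :
    liftNCRingHom (RingHom.id k) (1 : H →* k) (fun _ _ ↦ by simp) (subgroupProj H z) = 0 := by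
  set ε : MonoidAlgebra k H →+* k := liftNCRingHom (RingHom.id k) (1 : H →* k) (fun _ _ ↦ by simp) with hε
  have hε1 : ∀ h : H, ε (single h 1) = 1 := fun h ↦ by
    rw [hε, liftNCRingHom_single, MonoidHom.one_apply, mul_one, RingHom.id_apply]
  -- `λ(a·z) = 0` for all `a`, by induction over the span
  suffices h : ∀ a : MonoidAlgebra k G, ε (subgroupProj H (a * z)) = 0 by simpa using h 1
  refine Submodule.span_induction (p := fun z _ ↦ ∀ a : MonoidAlgebra k G, ε (subgroupProj H (a * z)) = 0) ?_ ?_ ?_ ?_ hz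
  · rintro _ ⟨s, hs, rfl⟩ a
    -- `s − 1 = i(s − 1)` with `s ∈ H`
    have h1 : (single s (1 : k) - 1 : MonoidAlgebra k G) = mapDomain H.subtype (single ⟨s, hS hs⟩ 1 - 1) := by
      change _ = mapDomainRingHom k H.subtype (single ⟨s, hS hs⟩ 1 - 1)
      rw [map_sub, map_one]
      change _ = mapDomain H.subtype (single _ 1) - 1
      rw [mapDomain_single, Subgroup.coe_subtype]
    change ε (subgroupProj H (a * (single s (1 : k) - 1))) = 0
    rw [h1, subgroupProj_mul_mapDomain, map_mul, map_sub, map_one, hε1, sub_self, mul_zero]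
  · intro a; rw [mul_zero, map_zero, map_zero]
  · intro x y _ _ hx hy a; rw [mul_add, map_add, map_add, hx a, hy a, add_zero]
  · intro b x _ hx a; rw [smul_eq_mul, ← mul_assoc]; exact hx (a * b)

/-- A nonzero `f ∈ kG` with `hf = f` for all `h ∈ H` forces `H` to be finite (left translation by `H` preserves the support of `f`).
[cite: Lam2001FirstCourse, §6 proof of Prop. (6.3) («`f` involves all group elements»); Exercise 6.21] -/
theorem finite_of_forall_single_mul_eq (H : Subgroup G) {f : MonoidAlgebra k G} (hf0 : f ≠ 0)
    (hf : ∀ h ∈ H, single h (1 : k) * f = f) : Finite H := by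
  obtain ⟨g, hg⟩ : ∃ g, f.coeff g ≠ 0 := by
    by_contra h
    exact hf0 (coeff_inj.1 (Finsupp.ext fun g ↦ not_not.1 (not_exists.1 h g)))
  have hcoeff : ∀ h : H, f.coeff ((h : G) * g) = f.coeff g := fun h ↦ by
    conv_lhs => rw [← hf h h.2]
    rw [coeff_single_mul_apply, one_mul, inv_mul_cancel_left]
  haveI : Finite (f.coeff.support : Set G) := f.coeff.support.finite_toSet.to_subtype
  refine Finite.of_injective (fun h : H ↦ (⟨(h : G) * g, Finset.mem_coe.2 (Finsupp.mem_support_iff.2 (by rw [hcoeff]; exact hg))⟩ :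
    (f.coeff.support : Set G))) fun h h' hh ↦ ?_
  exact Subtype.ext (mul_right_cancel (Subtype.ext_iff.1 hh))

/-- **LAM Exercise 6.21, «only if»: if `kG` is von Neumann regular (`k ≠ 0`), every finitely generated subgroup of `G` is finite — `G`
is locally finite.** [cite: Lam2001FirstCourse, §6 Exercise 6.21] -/
theorem finite_of_fg_of_forall_exists_mul_mul_self [Nontrivial k] (hR : ∀ x : MonoidAlgebra k G, ∃ y, x * y * x = x)
    (H : Subgroup G) (hH : H.FG) : Finite H := by
  classical
  obtain ⟨S, rfl⟩ := hH
  -- `L = Σᵢ kG(hᵢ − 1)` is a finitely generated left ideal, so `L = kG·e` for an idempotent `e`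
  let T : Set (MonoidAlgebra k G) := (fun s : G ↦ (single s (1 : k) - 1 : MonoidAlgebra k G)) '' (S : Set G)
  have hTfg : (Ideal.span T).FG := ⟨S.image fun s : G ↦ (single s (1 : k) - 1 : MonoidAlgebra k G), by rw [Finset.coe_image]⟩
  obtain ⟨e, he, hL⟩ := (forall_exists_mul_mul_self_iff_fg.1 hR) _ hTfg
  -- every `z ∈ L` satisfies `z·e = z`; in particular `(h − 1)(1 − e) = 0`, i.e. `h·(1 − e) = 1 − e`, for all `h ∈ H`
  have hze : ∀ z ∈ Ideal.span T, z * e = z := fun z hz ↦ by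
    rw [hL] at hz
    obtain ⟨a, rfl⟩ := Ideal.mem_span_singleton'.1 hz
    rw [mul_assoc, he.eq]
  have hf : ∀ h ∈ Subgroup.closure (S : Set G), single h (1 : k) * (1 - e) = 1 - e := fun h hh ↦ by
    have h1 := hze _ (single_sub_one_mem_span_of_mem_closure hh)
    rw [sub_mul, one_mul, sub_eq_iff_eq_add] at h1
    rw [mul_sub, mul_one, h1]
    abel
  -- `1 − e ≠ 0`: the functional `ε_H ∘ π_H` vanishes on `L ∋ e` but not at `1`
  have hf0 : (1 - e : MonoidAlgebra k G) ≠ 0 := fun h0 ↦ by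
    have he1 : e = 1 := (sub_eq_zero.1 h0).symm
    have h1 := augmentation_subgroupProj_eq_zero_of_mem_span (Subgroup.closure (S : Set G)) Subgroup.subset_closure
      (hL ▸ Ideal.mem_span_singleton_self e)
    rw [he1, subgroupProj_one, map_one] at h1
    exact one_ne_zero h1
  exact finite_of_forall_single_mul_eq _ hf0 hf

/-! ## §3 «If» for a semisimple coefficient ring; the characterisation over semisimple `k` -/

/-- **LAM Exercise 6.21, «if», for `k` semisimple: if `G` is locally finite and the order of every finite subgroup is a unit in `k`,
then `kG` is von Neumann regular** — `α ∈ kH` for the finite `H` generated by its support, and `kH` is semisimple by Maschke (6.1).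
[cite: Lam2001FirstCourse, §6 Exercise 6.21] -/
theorem monoidAlgebra_forall_exists_mul_mul_self_of_isSemisimpleRing [IsSemisimpleRing k] (hlf : ∀ H : Subgroup G, H.FG → Finite H)
    (hunit : ∀ H : Subgroup G, Finite H → IsUnit (Nat.card H : k)) : ∀ x : MonoidAlgebra k G, ∃ y, x * y * x = x := fun x ↦ by
  obtain ⟨H, hH, α, rfl⟩ := exists_fg_eq_mapDomain x
  haveI : Finite H := hlf H hH
  haveI : IsSemisimpleRing (MonoidAlgebra k H) := isSemisimpleRing_monoidAlgebra_of_isUnit_card k H (hunit H inferInstance)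
  obtain ⟨β, hβ⟩ := Literature.RingTheory.JacobsonRadical.forall_exists_mul_mul_self_of_isSemisimpleRing α
  exact ⟨mapDomain H.subtype β, by rw [← mapDomain_mul, ← mapDomain_mul, hβ]⟩

/-- **LAM Exercise 6.21 over a semisimple coefficient ring `k ≠ 0` (e.g. a field): `kG` is von Neumann regular iff `G` is locally
finite and the order of every finite subgroup of `G` is a unit in `k`.** [cite: Lam2001FirstCourse, §6 Exercise 6.21] -/
theorem forall_exists_mul_mul_self_iff_of_isSemisimpleRing [IsSemisimpleRing k] [Nontrivial k] :
    (∀ x : MonoidAlgebra k G, ∃ y, x * y * x = x) ↔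
      (∀ H : Subgroup G, H.FG → Finite H) ∧ ∀ H : Subgroup G, Finite H → IsUnit (Nat.card H : k) :=
  ⟨fun hR ↦ ⟨fun H hH ↦ finite_of_fg_of_forall_exists_mul_mul_self hR H hH, fun H _ ↦
    isUnit_natCard_of_forall_exists_mul_mul_self hR H⟩, fun h ↦ monoidAlgebra_forall_exists_mul_mul_self_of_isSemisimpleRing h.1 h.2⟩

/-- **LAM Exercise 6.21, «only if», complete: `kG` von Neumann regular (`k ≠ 0`) ⟹ `k` von Neumann regular, `G` locally finite, and all
finite subgroup orders units in `k`.** [cite: Lam2001FirstCourse, §6 Exercise 6.21] -/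
theorem vonNeumannRegular_only_if [Nontrivial k] (hR : ∀ x : MonoidAlgebra k G, ∃ y, x * y * x = x) :
    (∀ a : k, ∃ b, a * b * a = a) ∧ (∀ H : Subgroup G, H.FG → Finite H) ∧ ∀ H : Subgroup G, Finite H → IsUnit (Nat.card H : k) :=
  ⟨forall_exists_mul_mul_self_coeff hR, fun H hH ↦ finite_of_fg_of_forall_exists_mul_mul_self hR H hH, fun H _ ↦
    isUnit_natCard_of_forall_exists_mul_mul_self hR H⟩

end Literature.Algebra.GroupRings
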